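import Summits.QuantumFields.YangMills.Theorems.FradkinShenkerFlowSusceptibilityToPoincareBisectionGeometry

/-!
# Martinelli's scale recursion (helper for stub `stub_bisection`, C4)

Route `FradkinShenkerFlow` of `YangMills`, crux item `stmt-QuantumFields-9441`
(`Summit.QuantumFields.YangMills.Theses.FradkinShenkerFlow.SusceptibilityToPoincare`, FS ⇒ UP),
line `maxcorr-halving`, stub `stub_bisection`.  This file is the combinatorial core of the
bisection (Martinelli, Saint-Flour 1997, LNM 1717, Thm. 4.5; Martinelli–Olivieri 1994), written
for an abstract "variance functional" `v : Set (Site 4 L) → ℝ` on site sets of the torus of side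
`L = 2S+1` and a nonnegative edge weight `e` (the heat-bath weight of a site set `Q` is
`hb Q = Σ_ℓ 1[ℓ.1 ∈ Q] e ℓ`).

* `Bisect.boxes`: if `v` of every box (cylinder with interval sides) is bounded by
  `(1 - ρ^{m/2})⁻² (v child₁ + v child₂)` for the two children of a corridor cut of width `m R`
  (corridor decoupling) and `v Q ≤ Γ₀ hb Q` for boxes with all sides `≤ l 0` (base), then for
  scales `l`, corridor counts `s` and corridor multiplicities `m` with
  `l (k+1) + s k m k R ≤ 2 l k` and `s k m k R + R ≤ l k`, every box with all sides `≤ l k`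
  satisfies `v Q ≤ Γ₀ P_k⁴ hb Q`, `P_k = Π_{j<k} (1 - ρ^{m j/2})⁻² (1 + 1/s j)`: cut a long side
  at `s k` disjoint corridor positions, apply the decoupling, the induction hypothesis to the two
  children, and average over the positions (the corridors are disjoint, so the doubly counted
  weight is at most `hb Q / s k`).
* `Bisect.boxes_unif`: with `k ≤ l k` and `P_k ≤ P∞` this bounds every box uniformly.
* `Bisect.rings`, `Bisect.univ_le`: opening the (at most four) full-ring sides with the ring
  decoupling `(1-ρ)⁻² (v Λ₁ + v Λ₂)` costs a factor `2 (1-ρ)⁻²` each, whence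
  `v univ ≤ (2 (1-ρ)⁻²)⁴ Γ_box Σ_ℓ e ℓ`.
* `stub_bisection_recursion` (registered sub-goal): the whole abstract bisection with the explicit
  scales of `…BisectionGeometry`: ring + corridor decoupling + base bound for sides `≤ 52 R` ⟹
  `v univ ≤ (2 (1-ρ)⁻²)⁴ Γ₀ exp (2ρ/(1-ρ)² + 2)⁴ Σ_ℓ e ℓ`.
-/

open Literature.MathematicalPhysics.QuantumFieldTheory

namespace Summit.QuantumFields.YangMills.Theorems.SusceptibilityToPoincare

namespace Bisect

variable {S R : ℕ} {ρ Γ₀ : ℝ} (v : Set (Site 4 (2 * S + 1)) → ℝ) (e : Edge 4 (2 * S + 1) → ℝ)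

/-- One step factor `(1 - ρ^{m/2})⁻² (1 + 1/s)` is at least `1`. [folklore] -/
theorem one_le_stepFactor (hρ : 0 ≤ ρ) (hρ1 : ρ < 1) {m s : ℕ} (hm : 2 ≤ m) :
    (1 : ℝ) ≤ 1 / (1 - ρ ^ (m / 2)) ^ 2 * (1 + 1 / (s : ℝ)) := by
  have hx0 : 0 ≤ ρ ^ (m / 2) := pow_nonneg hρ _
  have hx1 : ρ ^ (m / 2) < 1 := pow_lt_one₀ hρ hρ1 (by omega)
  have h1 : 1 ≤ 1 / (1 - ρ ^ (m / 2)) ^ 2 := by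
    rw [one_le_div (by nlinarith)]
    exact pow_le_one₀ (by linarith) (by linarith)
  have h2 : (1 : ℝ) ≤ 1 + 1 / (s : ℝ) := le_add_of_nonneg_right (by positivity)
  nlinarith

/-- **Martinelli's scale recursion for boxes** (all sides intervals): corridor decoupling +
base-scale local Poincaré inequality ⟹ `v Q ≤ Γ₀ P_k⁴ hb Q` for every box with all sides
`≤ l k`. [folklore] -/
theorem boxes (hρ : 0 ≤ ρ) (hρ1 : ρ < 1) (hΓ₀ : 0 ≤ Γ₀)
    (l s m : ℕ → ℕ) (hs : ∀ k, 1 ≤ s k) (hm : ∀ k, 2 ≤ m k)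
    (hl : ∀ k, l (k + 1) + s k * (m k * R) ≤ 2 * l k) (hl' : ∀ k, s k * (m k * R) + R ≤ l k)
    (he : ∀ ℓ, 0 ≤ e ℓ)
    (hcorr : ∀ (a : Fin 4 → ZMod (2 * S + 1)) (n : Fin 4 → ℕ), (∀ ν, n ν ≤ 2 * S + 1) →
      ∀ Q : Set (Site 4 (2 * S + 1)), Q = {x | ∀ ν, (x ν - a ν).val < n ν} →
      ∀ i, n i ≤ 2 * S → ∀ c m' : ℕ, R ≤ c → 2 ≤ m' →
      v Q ≤ 1 / (1 - ρ ^ (m' / 2)) ^ 2 *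
        (v {x | x ∈ Q ∧ c ≤ (x i - a i).val} + v {x | x ∈ Q ∧ (x i - a i).val < c + m' * R}))
    (hbase : ∀ (a : Fin 4 → ZMod (2 * S + 1)) (n : Fin 4 → ℕ), (∀ ν, n ν ≤ l 0) →
      (∀ ν, n ν ≤ 2 * S + 1) →
      v {x | ∀ ν, (x ν - a ν).val < n ν} ≤
        Γ₀ * ∑ ℓ, {ℓ : Edge 4 (2 * S + 1) | ℓ.1 ∈ {x | ∀ ν, (x ν - a ν).val < n ν}}.indicator e ℓ)
    (k : ℕ) :
    ∀ (a : Fin 4 → ZMod (2 * S + 1)) (n : Fin 4 → ℕ), (∀ ν, n ν ≤ 2 * S) → (∀ ν, n ν ≤ l k) →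
      v {x | ∀ ν, (x ν - a ν).val < n ν} ≤
        Γ₀ * (∏ j ∈ Finset.range k, (1 / (1 - ρ ^ (m j / 2)) ^ 2 * (1 + 1 / (s j : ℝ)))) ^ 4 *
          ∑ ℓ, {ℓ : Edge 4 (2 * S + 1) | ℓ.1 ∈ {x | ∀ ν, (x ν - a ν).val < n ν}}.indicator e ℓ := by
  have hA0 : ∀ k, (0 : ℝ) ≤ 1 / (1 - ρ ^ (m k / 2)) ^ 2 * (1 + 1 / (s k : ℝ)) := fun k =>
    zero_le_one.trans (one_le_stepFactor hρ hρ1 (hm k))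
  induction k with
  | zero =>
    intro a n h2S hl0
    simpa using hbase a n hl0 fun ν => (h2S ν).trans (Nat.le_succ _)
  | succ k ih =>
    obtain ⟨P, hP⟩ : ∃ P : ℝ, P = ∏ j ∈ Finset.range k,
        (1 / (1 - ρ ^ (m j / 2)) ^ 2 * (1 + 1 / (s j : ℝ))) := ⟨_, rfl⟩
    obtain ⟨B, hB⟩ : ∃ B : ℝ, B = 1 / (1 - ρ ^ (m k / 2)) ^ 2 := ⟨_, rfl⟩
    obtain ⟨A, hA⟩ : ∃ A : ℝ, A = B * (1 + 1 / (s k : ℝ)) := ⟨_, rfl⟩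
    have hP0 : 0 ≤ P := hP ▸ Finset.prod_nonneg fun j _ => hA0 j
    have hA1 : 1 ≤ A := by rw [hA, hB]; exact one_le_stepFactor hρ hρ1 (hm k)
    have hB0 : 0 ≤ B := by rw [hB]; positivity
    have hsk : (0 : ℝ) < s k := by exact_mod_cast hs k
    rw [← hP] at ih
    rw [Finset.prod_range_succ, ← hP, ← hB, ← hA]
    -- inner induction on the number `j` of sides longer than `l k`
    suffices inner : ∀ (j : ℕ) (a : Fin 4 → ZMod (2 * S + 1)) (n : Fin 4 → ℕ),
        (∀ ν, n ν ≤ 2 * S) → (∀ ν, n ν ≤ l (k + 1)) →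
        (Finset.univ.filter fun ν => l k < n ν).card ≤ j →
        v {x | ∀ ν, (x ν - a ν).val < n ν} ≤ Γ₀ * P ^ 4 * A ^ j *
          ∑ ℓ, {ℓ : Edge 4 (2 * S + 1) | ℓ.1 ∈ {x | ∀ ν, (x ν - a ν).val < n ν}}.indicator e ℓ by
      intro a n h2S hl1
      have h := inner 4 a n h2S hl1
        ((Finset.card_filter_le _ _).trans (by simp))
      simpa only [mul_pow, mul_assoc] using h
    intro j
    induction j with
    | zero =>
      intro a n h2S _ hcard
      have h0 : ∀ ν, n ν ≤ l k := fun ν => not_lt.1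
        (Finset.filter_eq_empty_iff.1 (Finset.card_eq_zero.1 (Nat.le_zero.1 hcard))
          (Finset.mem_univ ν))
      simpa using ih a n h2S h0
    | succ j ihj =>
      intro a n h2S hl1 hcard
      by_cases hc : (Finset.univ.filter fun ν => l k < n ν).card ≤ j
      · refine (ihj a n h2S hl1 hc).trans (mul_le_mul_of_nonneg_right ?_ (hb_nonneg e he _))
        exact mul_le_mul_of_nonneg_left (pow_le_pow_right₀ hA1 (Nat.le_succ j))
          (mul_nonneg hΓ₀ (pow_nonneg hP0 4))
      -- a long side `i` exists: cut it
      obtain ⟨i, hi⟩ := Finset.card_pos.1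
        (by omega : 0 < (Finset.univ.filter fun ν => l k < n ν).card)
      have hki : l k < n i := (Finset.mem_filter.1 hi).2
      have hlk := hl k
      have hl'k := hl' k
      have hni : n i ≤ 2 * S := h2S i
      have hnl : n i ≤ l (k + 1) := hl1 i
      have h2S' : ∀ ν, n ν ≤ 2 * S + 1 := fun ν => (h2S ν).trans (Nat.le_succ _)
      -- first corridor position `c₀`, corridor width `m k * R`, `s k` positions
      obtain ⟨c₀, hc₀⟩ : ∃ c₀ : ℕ, c₀ = max (n i - l k) R := ⟨_, rfl⟩
      have hc₀R : R ≤ c₀ := hc₀ ▸ le_max_right _ _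
      have hc₀n : n i - l k ≤ c₀ := hc₀ ▸ le_max_left _ _
      have hfit : c₀ + s k * (m k * R) ≤ l k := by
        rcases le_total (n i - l k) R with h | h
        · rw [hc₀, max_eq_right h]; omega
        · rw [hc₀, max_eq_left h]; omega
      obtain ⟨Γ', hΓ'⟩ : ∃ Γ' : ℝ, Γ' = Γ₀ * P ^ 4 * A ^ j := ⟨_, rfl⟩
      have hΓ'0 : 0 ≤ Γ' := by
        rw [hΓ']; exact mul_nonneg (mul_nonneg hΓ₀ (pow_nonneg hP0 4))
          (pow_nonneg (zero_le_one.trans hA1) j)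
      -- the box and its weight
      obtain ⟨Q, hQ⟩ : ∃ Q : Set (Site 4 (2 * S + 1)), Q = {x | ∀ ν, (x ν - a ν).val < n ν} :=
        ⟨_, rfl⟩
      rw [← hQ]
      obtain ⟨hbQ, hhbQ⟩ : ∃ t : ℝ, t = ∑ ℓ, {ℓ : Edge 4 (2 * S + 1) | ℓ.1 ∈ Q}.indicator e ℓ :=
        ⟨_, rfl⟩
      rw [← hhbQ]
      -- bound at each corridor position `p`
      have hp : ∀ p ∈ Finset.range (s k), v Q ≤ B * Γ' * (hbQ +
          ∑ ℓ, {ℓ : Edge 4 (2 * S + 1) | ℓ.1 ∈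
            {x | x ∈ Q ∧ (x i - a i).val < c₀ + p * (m k * R) + m k * R} ∩
            {x | x ∈ Q ∧ c₀ + p * (m k * R) ≤ (x i - a i).val}}.indicator e ℓ) := by
        intro p hp
        rw [Finset.mem_range] at hp
        have hpw : p * (m k * R) + m k * R ≤ s k * (m k * R) := by
          have h := Nat.mul_le_mul_right (m k * R) (Nat.succ_le_of_lt hp)
          rwa [Nat.succ_mul] at h
        have hRc : R ≤ c₀ + p * (m k * R) := hc₀R.trans (Nat.le_add_right _ _)
        have hcw : c₀ + p * (m k * R) + m k * R ≤ l k := by omega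
        have hcn : c₀ + p * (m k * R) ≤ n i := by omega
        have hcL : c₀ + p * (m k * R) < 2 * S + 1 := by omega
        have hnL : n i ≤ 2 * S + 1 := by omega
        -- corridor decoupling
        have hdec := hcorr a n h2S' Q hQ i hni (c₀ + p * (m k * R)) (m k) hRc (hm k)
        rw [← hB] at hdec
        -- the two children are boxes with `≤ j` long sides
        have e1 := cyl_inter_lt a n i (c₀ + p * (m k * R) + m k * R)
        have e2 := cyl_inter_le a n i hcn hnL hcL
        rw [← hQ] at e1 e2
        have hside1 : ∀ ν, Function.update n i (min (n i) (c₀ + p * (m k * R) + m k * R)) ν ≤ n ν :=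
          fun ν => by
            rcases eq_or_ne ν i with rfl | hν
            · rw [Function.update_self]; exact min_le_left _ _
            · rw [Function.update_of_ne hν]
        have hside2 : ∀ ν, Function.update n i (n i - (c₀ + p * (m k * R))) ν ≤ n ν := fun ν => by
          rcases eq_or_ne ν i with rfl | hν
          · rw [Function.update_self]; exact Nat.sub_le _ _
          · rw [Function.update_of_ne hν]
        have hcard1 : (Finset.univ.filter fun ν =>
            l k < Function.update n i (min (n i) (c₀ + p * (m k * R) + m k * R)) ν).card ≤ j := by
          have h := card_filter_update_lt n i (min (n i) (c₀ + p * (m k * R) + m k * R))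
            (fun t => l k < t) (by simp only [not_lt]; exact (min_le_right _ _).trans hcw) hki
          omega
        have hcard2 : (Finset.univ.filter fun ν =>
            l k < Function.update n i (n i - (c₀ + p * (m k * R))) ν).card ≤ j := by
          have h := card_filter_update_lt n i (n i - (c₀ + p * (m k * R)))
            (fun t => l k < t) (by simp only [not_lt]; omega) hki
          omega
        have hv1 := ihj a _ (fun ν => (hside1 ν).trans (h2S ν)) (fun ν => (hside1 ν).trans (hl1 ν))
          hcard1
        have hv2 := ihj (Function.update a i (a i + ((c₀ + p * (m k * R) : ℕ) : ZMod (2 * S + 1))))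
          _ (fun ν => (hside2 ν).trans (h2S ν)) (fun ν => (hside2 ν).trans (hl1 ν)) hcard2
        rw [← e1, ← hΓ'] at hv1
        rw [← e2, ← hΓ'] at hv2
        -- weights: `hb Λ₁ + hb Λ₂ = hb Q + hb corridor`
        have hval := hb_union_add_inter e {x | x ∈ Q ∧ (x i - a i).val < c₀ + p * (m k * R) + m k * R}
          {x | x ∈ Q ∧ c₀ + p * (m k * R) ≤ (x i - a i).val}
        rw [inter_lt_union_inter_le Q (fun x => (x i - a i).val) _ _ (Nat.le_add_right _ _),
          ← hhbQ] at hval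
        calc v Q ≤ B * (v {x | x ∈ Q ∧ c₀ + p * (m k * R) ≤ (x i - a i).val} +
              v {x | x ∈ Q ∧ (x i - a i).val < c₀ + p * (m k * R) + m k * R}) := hdec
          _ ≤ B * (Γ' * ∑ ℓ, {ℓ : Edge 4 (2 * S + 1) | ℓ.1 ∈
                {x | x ∈ Q ∧ c₀ + p * (m k * R) ≤ (x i - a i).val}}.indicator e ℓ +
              Γ' * ∑ ℓ, {ℓ : Edge 4 (2 * S + 1) | ℓ.1 ∈
                {x | x ∈ Q ∧ (x i - a i).val < c₀ + p * (m k * R) + m k * R}}.indicator e ℓ) :=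
            mul_le_mul_of_nonneg_left (add_le_add hv2 hv1) hB0
          _ = _ := by rw [← mul_add, add_comm, hval]; ring
      -- average over the `s k` positions
      have hsum : (s k : ℝ) * v Q ≤ B * Γ' * ((s k : ℝ) * hbQ + hbQ) := by
        calc (s k : ℝ) * v Q = ∑ _p ∈ Finset.range (s k), v Q := by simp
          _ ≤ _ := Finset.sum_le_sum hp
          _ = B * Γ' * ((s k : ℝ) * hbQ + ∑ p ∈ Finset.range (s k),
                ∑ ℓ, {ℓ : Edge 4 (2 * S + 1) | ℓ.1 ∈
                  {x | x ∈ Q ∧ (x i - a i).val < c₀ + p * (m k * R) + m k * R} ∩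
                  {x | x ∈ Q ∧ c₀ + p * (m k * R) ≤ (x i - a i).val}}.indicator e ℓ) := by
            rw [← Finset.mul_sum, Finset.sum_add_distrib]; simp
          _ ≤ B * Γ' * ((s k : ℝ) * hbQ + hbQ) := by
            refine mul_le_mul_of_nonneg_left (add_le_add le_rfl ?_) (mul_nonneg hB0 hΓ'0)
            rw [hhbQ]
            exact sum_hb_corridor_le e he Q (fun x => (x i - a i).val) c₀ (m k * R) (s k)
      refine le_of_mul_le_mul_left (hsum.trans (le_of_eq ?_)) hsk
      have hs1 : (s k : ℝ) * (1 + 1 / (s k : ℝ)) = s k + 1 := by field_simp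
      calc B * Γ' * ((s k : ℝ) * hbQ + hbQ)
          = B * Γ' * hbQ * ((s k : ℝ) * (1 + 1 / (s k : ℝ))) := by rw [hs1]; ring
        _ = (s k : ℝ) * (Γ₀ * P ^ 4 * A ^ (j + 1) * hbQ) := by rw [pow_succ, hΓ', hA]; ring

/-- **Uniform local Poincaré constant for boxes**: with `k ≤ l k` and `P_k ≤ P∞`, every box with
interval sides satisfies `v Q ≤ Γ₀ P∞⁴ hb Q`. [folklore] -/
theorem boxes_unif {Pinf : ℝ} (hρ : 0 ≤ ρ) (hρ1 : ρ < 1) (hΓ₀ : 0 ≤ Γ₀)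
    (l s m : ℕ → ℕ) (hs : ∀ k, 1 ≤ s k) (hm : ∀ k, 2 ≤ m k)
    (hl : ∀ k, l (k + 1) + s k * (m k * R) ≤ 2 * l k) (hl' : ∀ k, s k * (m k * R) + R ≤ l k)
    (hlk : ∀ k, k ≤ l k)
    (hP : ∀ k, ∏ j ∈ Finset.range k, (1 / (1 - ρ ^ (m j / 2)) ^ 2 * (1 + 1 / (s j : ℝ))) ≤ Pinf)
    (he : ∀ ℓ, 0 ≤ e ℓ)
    (hcorr : ∀ (a : Fin 4 → ZMod (2 * S + 1)) (n : Fin 4 → ℕ), (∀ ν, n ν ≤ 2 * S + 1) →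
      ∀ Q : Set (Site 4 (2 * S + 1)), Q = {x | ∀ ν, (x ν - a ν).val < n ν} →
      ∀ i, n i ≤ 2 * S → ∀ c m' : ℕ, R ≤ c → 2 ≤ m' →
      v Q ≤ 1 / (1 - ρ ^ (m' / 2)) ^ 2 *
        (v {x | x ∈ Q ∧ c ≤ (x i - a i).val} + v {x | x ∈ Q ∧ (x i - a i).val < c + m' * R}))
    (hbase : ∀ (a : Fin 4 → ZMod (2 * S + 1)) (n : Fin 4 → ℕ), (∀ ν, n ν ≤ l 0) →
      (∀ ν, n ν ≤ 2 * S + 1) →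
      v {x | ∀ ν, (x ν - a ν).val < n ν} ≤
        Γ₀ * ∑ ℓ, {ℓ : Edge 4 (2 * S + 1) | ℓ.1 ∈ {x | ∀ ν, (x ν - a ν).val < n ν}}.indicator e ℓ)
    (a : Fin 4 → ZMod (2 * S + 1)) (n : Fin 4 → ℕ) (h2S : ∀ ν, n ν ≤ 2 * S) :
    v {x | ∀ ν, (x ν - a ν).val < n ν} ≤
      Γ₀ * Pinf ^ 4 * ∑ ℓ, {ℓ : Edge 4 (2 * S + 1) | ℓ.1 ∈ {x | ∀ ν, (x ν - a ν).val < n ν}}.indicator e ℓ := by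
  have h := boxes v e hρ hρ1 hΓ₀ l s m hs hm hl hl' he hcorr hbase (2 * S) a n h2S
    fun ν => (h2S ν).trans (hlk _)
  refine h.trans (mul_le_mul_of_nonneg_right (mul_le_mul_of_nonneg_left ?_ hΓ₀) (hb_nonneg e he _))
  exact pow_le_pow_left₀ (Finset.prod_nonneg fun j _ =>
    zero_le_one.trans (one_le_stepFactor hρ hρ1 (hm j))) (hP _) 4

/-- **Opening the rings**: ring decoupling + the box bound ⟹ a cylinder with at most `j` full-ring
sides satisfies `v Q ≤ (2 (1-ρ)⁻²)^j Γ_box hb Q`. [folklore] -/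
theorem rings {Γb : ℝ} (hR : 1 ≤ R) (hRS : 2 * R ≤ S) (hρ : 0 ≤ ρ) (hρ1 : ρ < 1) (hΓb : 0 ≤ Γb)
    (he : ∀ ℓ, 0 ≤ e ℓ)
    (hring : ∀ (a : Fin 4 → ZMod (2 * S + 1)) (n : Fin 4 → ℕ), (∀ ν, n ν ≤ 2 * S + 1) →
      ∀ Q : Set (Site 4 (2 * S + 1)), Q = {x | ∀ ν, (x ν - a ν).val < n ν} →
      ∀ i, n i = 2 * S + 1 → ∀ b : ZMod (2 * S + 1),
      v Q ≤ 1 / (1 - ρ) ^ 2 * (v {x | x ∈ Q ∧ R ≤ (x i - b).val} +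
        v {x | x ∈ Q ∧ R ≤ (x i - b - (S : ZMod (2 * S + 1))).val}))
    (hbox : ∀ (a : Fin 4 → ZMod (2 * S + 1)) (n : Fin 4 → ℕ), (∀ ν, n ν ≤ 2 * S) →
      v {x | ∀ ν, (x ν - a ν).val < n ν} ≤
        Γb * ∑ ℓ, {ℓ : Edge 4 (2 * S + 1) | ℓ.1 ∈ {x | ∀ ν, (x ν - a ν).val < n ν}}.indicator e ℓ)
    (j : ℕ) :
    ∀ (a : Fin 4 → ZMod (2 * S + 1)) (n : Fin 4 → ℕ), (∀ ν, n ν ≤ 2 * S + 1) →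
      (Finset.univ.filter fun ν => n ν = 2 * S + 1).card ≤ j →
      v {x | ∀ ν, (x ν - a ν).val < n ν} ≤ (2 / (1 - ρ) ^ 2) ^ j * Γb *
        ∑ ℓ, {ℓ : Edge 4 (2 * S + 1) | ℓ.1 ∈ {x | ∀ ν, (x ν - a ν).val < n ν}}.indicator e ℓ := by
  have hf1 : (1 : ℝ) ≤ 2 / (1 - ρ) ^ 2 := by
    rw [le_div_iff₀ (by nlinarith)]; nlinarith
  induction j with
  | zero =>
    intro a n hn hcard
    have h0 : ∀ ν, n ν ≤ 2 * S := fun ν => by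
      have h := Finset.filter_eq_empty_iff.1 (Finset.card_eq_zero.1 (Nat.le_zero.1 hcard))
        (Finset.mem_univ ν)
      have := hn ν
      omega
    simpa using hbox a n h0
  | succ j ihj =>
    intro a n hn hcard
    by_cases hc : (Finset.univ.filter fun ν => n ν = 2 * S + 1).card ≤ j
    · refine (ihj a n hn hc).trans (mul_le_mul_of_nonneg_right ?_ (hb_nonneg e he _))
      exact mul_le_mul_of_nonneg_right (pow_le_pow_right₀ hf1 (Nat.le_succ j)) hΓb
    obtain ⟨i, hi⟩ := Finset.card_pos.1
      (by omega : 0 < (Finset.univ.filter fun ν => n ν = 2 * S + 1).card)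
    have hni : n i = 2 * S + 1 := (Finset.mem_filter.1 hi).2
    obtain ⟨Q, hQ⟩ : ∃ Q : Set (Site 4 (2 * S + 1)), Q = {x | ∀ ν, (x ν - a ν).val < n ν} :=
      ⟨_, rfl⟩
    rw [← hQ]
    have hdec := hring a n hn Q hQ i hni (a i)
    -- the two children are cylinders with `≤ j` ring sides
    have hRn : R ≤ n i := by omega
    have hnL : n i ≤ 2 * S + 1 := hni.le
    have hRL : R < 2 * S + 1 := by omega
    have hside : ∀ ν, Function.update n i (n i - R) ν ≤ 2 * S + 1 := fun ν => by
      rcases eq_or_ne ν i with rfl | hν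
      · rw [Function.update_self]; omega
      · rw [Function.update_of_ne hν]; exact hn ν
    have hcard' : (Finset.univ.filter fun ν => Function.update n i (n i - R) ν = 2 * S + 1).card ≤ j := by
      have h := card_filter_update_lt n i (n i - R) (fun t => t = 2 * S + 1) (by omega) hni
      omega
    have e1 := cyl_inter_le a n i hRn hnL hRL
    rw [← hQ] at e1
    have hv1 := ihj (Function.update a i (a i + (R : ZMod (2 * S + 1)))) _ hside hcard'
    rw [← e1] at hv1
    -- second child: re-base the ring at `a i + S`
    have e2 := cyl_inter_le (Function.update a i (a i + (S : ZMod (2 * S + 1)))) n i hRn hnL hRL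
    rw [← cyl_rebase a n i hni, ← hQ, Function.update_self, Function.update_idem] at e2
    have hset : {x | x ∈ Q ∧ R ≤ (x i - a i - (S : ZMod (2 * S + 1))).val} =
        {x | x ∈ Q ∧ R ≤ (x i - (a i + (S : ZMod (2 * S + 1)))).val} := by
      simp only [sub_add_eq_sub_sub]
    have hv2 := ihj (Function.update a i (a i + (S : ZMod (2 * S + 1)) + (R : ZMod (2 * S + 1))))
      _ hside hcard'
    rw [← e2, ← hset] at hv2
    have hm1 := hb_mono e he (show {x | x ∈ Q ∧ R ≤ (x i - a i).val} ⊆ Q from fun x hx => hx.1)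
    have hm2 := hb_mono e he
      (show {x | x ∈ Q ∧ R ≤ (x i - a i - (S : ZMod (2 * S + 1))).val} ⊆ Q from fun x hx => hx.1)
    have hK0 : 0 ≤ (2 / (1 - ρ) ^ 2) ^ j * Γb := mul_nonneg (pow_nonneg (zero_le_one.trans hf1) j) hΓb
    have hB0 : (0 : ℝ) ≤ 1 / (1 - ρ) ^ 2 := by positivity
    calc v Q ≤ 1 / (1 - ρ) ^ 2 * (v {x | x ∈ Q ∧ R ≤ (x i - a i).val} +
          v {x | x ∈ Q ∧ R ≤ (x i - a i - (S : ZMod (2 * S + 1))).val}) := hdec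
      _ ≤ 1 / (1 - ρ) ^ 2 * ((2 / (1 - ρ) ^ 2) ^ j * Γb *
            ∑ ℓ, {ℓ : Edge 4 (2 * S + 1) | ℓ.1 ∈ Q}.indicator e ℓ +
          (2 / (1 - ρ) ^ 2) ^ j * Γb * ∑ ℓ, {ℓ : Edge 4 (2 * S + 1) | ℓ.1 ∈ Q}.indicator e ℓ) :=
        mul_le_mul_of_nonneg_left (add_le_add (hv1.trans (mul_le_mul_of_nonneg_left hm1 hK0))
          (hv2.trans (mul_le_mul_of_nonneg_left hm2 hK0))) hB0
      _ = _ := by rw [pow_succ]; ring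

/-- **Local Poincaré inequality of the whole torus** from ring decoupling and the box bound:
`v univ ≤ (2 (1-ρ)⁻²)⁴ Γ_box Σ_ℓ e ℓ`. [folklore] -/
theorem univ_le {Γb : ℝ} (hR : 1 ≤ R) (hRS : 2 * R ≤ S) (hρ : 0 ≤ ρ) (hρ1 : ρ < 1) (hΓb : 0 ≤ Γb)
    (he : ∀ ℓ, 0 ≤ e ℓ)
    (hring : ∀ (a : Fin 4 → ZMod (2 * S + 1)) (n : Fin 4 → ℕ), (∀ ν, n ν ≤ 2 * S + 1) →
      ∀ Q : Set (Site 4 (2 * S + 1)), Q = {x | ∀ ν, (x ν - a ν).val < n ν} →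
      ∀ i, n i = 2 * S + 1 → ∀ b : ZMod (2 * S + 1),
      v Q ≤ 1 / (1 - ρ) ^ 2 * (v {x | x ∈ Q ∧ R ≤ (x i - b).val} +
        v {x | x ∈ Q ∧ R ≤ (x i - b - (S : ZMod (2 * S + 1))).val}))
    (hbox : ∀ (a : Fin 4 → ZMod (2 * S + 1)) (n : Fin 4 → ℕ), (∀ ν, n ν ≤ 2 * S) →
      v {x | ∀ ν, (x ν - a ν).val < n ν} ≤
        Γb * ∑ ℓ, {ℓ : Edge 4 (2 * S + 1) | ℓ.1 ∈ {x | ∀ ν, (x ν - a ν).val < n ν}}.indicator e ℓ) :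
    v Set.univ ≤ (2 / (1 - ρ) ^ 2) ^ 4 * Γb * ∑ ℓ, e ℓ := by
  have h := rings v e hR hRS hρ hρ1 hΓb he hring hbox 4 0 (fun _ => 2 * S + 1) (fun _ => le_rfl)
    ((Finset.card_filter_le _ _).trans (by simp))
  rwa [cyl_eq_univ (L := 2 * S + 1) 0 (fun _ => 2 * S + 1) (fun _ => rfl), hb_univ] at h

end Bisect

open Bisect in
/-- **Registered sub-goal `stub_bisection_recursion` of stub `stub_bisection` (C4): Martinelli's
bisection in abstract form.**  On the torus of side `2S+1` with `2R ≤ S`, `R ≥ 1`, `0 ≤ ρ < 1`,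
`Γ₀ ≥ 0`: if a functional `v` of site sets satisfies the ring decoupling
`v Q ≤ (1-ρ)⁻² (v Λ₁ + v Λ₂)` (antipodal `R`-slabs of a full-ring side removed), the corridor
decoupling `v Q ≤ (1-ρ^{m/2})⁻² (v Λ₁ + v Λ₂)` (corridor of `m ≥ 2` slabs at offset `c ≥ R` of an
interval side) and the base bound `v Q ≤ Γ₀ hb Q` for cylinders with all sides `≤ 52 R`, then
`v univ ≤ (2 (1-ρ)⁻²)⁴ Γ₀ exp (2ρ/(1-ρ)² + 2)⁴ Σ_ℓ e ℓ` (explicit scales of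
`…BisectionGeometry`, `Bisect.boxes_unif`, `Bisect.univ_le`). [folklore] -/
theorem stub_bisection_recursion :
    ∀ (S R : ℕ) (ρ Γ₀ : ℝ) (v : Set (Site 4 (2 * S + 1)) → ℝ) (e : Edge 4 (2 * S + 1) → ℝ),
      1 ≤ R → 2 * R ≤ S → 0 ≤ ρ → ρ < 1 → 0 ≤ Γ₀ → (∀ ℓ, 0 ≤ e ℓ) →
      (∀ (a : Fin 4 → ZMod (2 * S + 1)) (n : Fin 4 → ℕ), (∀ ν, n ν ≤ 2 * S + 1) →
        ∀ Q : Set (Site 4 (2 * S + 1)), Q = {x | ∀ ν, (x ν - a ν).val < n ν} →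
        ∀ i, n i = 2 * S + 1 → ∀ b : ZMod (2 * S + 1),
        v Q ≤ 1 / (1 - ρ) ^ 2 * (v {x | x ∈ Q ∧ R ≤ (x i - b).val} +
          v {x | x ∈ Q ∧ R ≤ (x i - b - (S : ZMod (2 * S + 1))).val})) →
      (∀ (a : Fin 4 → ZMod (2 * S + 1)) (n : Fin 4 → ℕ), (∀ ν, n ν ≤ 2 * S + 1) →
        ∀ Q : Set (Site 4 (2 * S + 1)), Q = {x | ∀ ν, (x ν - a ν).val < n ν} →
        ∀ i, n i ≤ 2 * S → ∀ c m : ℕ, R ≤ c → 2 ≤ m →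
        v Q ≤ 1 / (1 - ρ ^ (m / 2)) ^ 2 *
          (v {x | x ∈ Q ∧ c ≤ (x i - a i).val} + v {x | x ∈ Q ∧ (x i - a i).val < c + m * R})) →
      (∀ (a : Fin 4 → ZMod (2 * S + 1)) (n : Fin 4 → ℕ), (∀ ν, n ν ≤ 52 * R) →
        (∀ ν, n ν ≤ 2 * S + 1) →
        v {x | ∀ ν, (x ν - a ν).val < n ν} ≤
          Γ₀ * ∑ ℓ, {ℓ : Edge 4 (2 * S + 1) | ℓ.1 ∈ {x | ∀ ν, (x ν - a ν).val < n ν}}.indicator e ℓ) →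
      v Set.univ ≤ (2 / (1 - ρ) ^ 2) ^ 4 * (Γ₀ * Real.exp (2 * ρ / (1 - ρ) ^ 2 + 2) ^ 4) *
        ∑ ℓ, e ℓ := by
  intro S R ρ Γ₀ v e hR hRS hρ hρ1 hΓ₀ he hring hcorr hbase
  have h52 : (fun k : ℕ => R * (2 * k ^ 3 + 12 * k ^ 2 + 36 * k + 52)) 0 ≤ 52 * R := by
    show R * (2 * 0 ^ 3 + 12 * 0 ^ 2 + 36 * 0 + 52) ≤ 52 * R
    omega
  have hbox := boxes_unif v e hρ hρ1 hΓ₀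
    (fun k => R * (2 * k ^ 3 + 12 * k ^ 2 + 36 * k + 52)) (fun k => (k + 1) ^ 2)
    (fun k => 2 * (k + 1)) (fun k => Nat.one_le_pow _ _ (Nat.succ_pos k))
    (fun k => by show 2 ≤ 2 * (k + 1); omega) (scales_fit R) (scales_fit' R) (le_scales hR)
    (prod_stepFactor_le hρ hρ1) he hcorr
    (fun a n hn0 hnL => hbase a n (fun ν => (hn0 ν).trans h52) hnL)
  exact univ_le v e hR hRS hρ hρ1 (by positivity) he hring hbox

end Summit.QuantumFields.YangMills.Theorems.SusceptibilityToPoincare
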